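import Literature.NumberTheory.GaloisRepresentations.IdeleClassBarKSLayers
import Literature.Algebra.Homology.DiscreteRepLayerBoundary
import HarnessLib

/-!
# THE invariant map of `(G_S, C_{K_S})`, `inv_{K_S} : H²(G_S, C_{K_S}) = Ext²_{C_{G_S}}(ℤ, C_{K_S}) ↪ ℚ/ℤ`, and its compatibility
# with `inv_S` along `C_{K_S} ↠ C̄_S`: `inv_S ∘ (C_{K_S} ↠ C̄_S)_* = inv_{K_S}` (Harari Def. 16.3, Thm. 17.2; Milne ADT I §4)

Topic `NumberTheory/GaloisRepresentations`; namespace `Literature.NumberTheory.GaloisRepresentations.IdeleClassBar`.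
Definitions with bodies (`layerInvKS`, `invKS`) and theorems; NO named fact, no instance, no notation, no `sorry`; number
fields in `Type`.  Sequel to this seat's `IdeleClassBarKSLayers` (`layerKSCohomologyIso S hE n : Hⁿ(G_S ⧸ V̄_E, C_{K_S}^{V̄_E}) ≅
Hⁿ(Gal(E/K), C_E)`; the transitions are `classInf`; `C_{K_S} ↠ C̄_S` is `π_E` on the layers) and `IdeleClassBarSInvariant` (`invS`,
`layerInvS`, `invS_inflG`), to door-c5/door-c6's `IdeleClassInvariant(Naturality)` (`classInvAll K E`, `classInvAll_classInf`), to this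
seat's `IdeleClassModUnitsSInvariant` (`classModUnitsInv_map_π`: `inv_{C_S(E)} ∘ H²(π_E) = inv_{E/K}`), and to door-c4's
`DiscreteRepLayerColimitDesc` (`LayerColimit.desc`) / `DiscreteRepLayerBoundary` (`LayerColimit.inflG_map`).

THE POINT.  `(G_S, C_{K_S} = C̄^{N_S})` is the restriction to `K_S/K` of the idèle class formation: its layers are the
`(Gal(E/K), C_E)`, `E ⊂ K_S`, with the invariant maps `inv_{E/K}`, compatible with inflation, whence by door-c4's descent
**`invKS S : Ext²_{C_{G_S}}(ℤ, C_{K_S}) →+ ℚ/ℤ`** (§2; injective, values on inflated classes, uniqueness).  The projection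
`C_{K_S} ↠ C̄_S = C_{K_S} ⧸ Ū_S` reads `π_E : C_E ↠ C_S(E)` on the layers and `inv_{C_S(E)} ∘ H²(π_E) = inv_{E/K}` (Harari Thm. 17.2:
`U_S` is cohomologically trivial), hence **`inv_S ∘ (C_{K_S} ↠ C̄_S)_* = inv_{K_S}`** on `Ext²` (§3, `invS_comp_mk₀_toClassBarSD`) —
the identity (★1) of bsd-line-x1-p1-w6's F2D scoping (the left-hand side of the reciprocity identity (R4)_S splits through
`C_{K_S}`; the remaining comparison (★2) `inv_{K_S} = inv_K ∘ (inflation Γ_K ↠ G_S)` is characterised here by `eq_invKS_of_forall_inflG`).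

Cell `bsd-eis`, background lane «PT-Ш-S-TC» of crux `GoodLatticeBDPValue` (stmt-BirchSwinnertonDyer-19032), brick (★1), seat
bsd-line-x1-p1-w5 g10.  HONEST FRAMING: classical class field theory bookkeeping in the tree's normalisation; no duality theorem,
no case of Poitou–Tate and no case of BSD is proved here.

## References
* D. Harari, *Galois Cohomology and Class Field Theory* (2020), §16.1 Def. 16.3, §17.1 Thm. 17.2 (the `P`-class formation
  `(G_S, C_S)` and `C^{H_S} → C_S`). [Harari2020]
* J. S. Milne, *Arithmetic Duality Theorems* (2nd ed. 2006), I §4 (p. 55: `C_S = lim C_{F,S}`, the `P`-class formation). [MilneADT2006]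
* J. W. S. Cassels, A. Fröhlich (eds.), *Algebraic Number Theory* (1967), Ch. VII (J. Tate) §11.2 (bis). [CasselsFrohlichANT1967]
* J.-P. Serre, *Galois Cohomology* (1997), I §2.2 Proposition 8. [SerreGaloisCohomology1997]
-/

noncomputable section

open NumberField IsDedekindDomain CategoryTheory CategoryTheory.Limits CategoryTheory.Abelian groupCohomology
open Field (absoluteGaloisGroup)
open Literature.NumberTheory.Automorphic Literature.NumberTheory.Automorphic.IdeleClassGroup
open Literature.NumberTheory.NumberFields
open Literature.Algebra.Homology Literature.Algebra.Homology.DiscreteRep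
open Literature.NumberTheory.GaloisRepresentations.LocalWeilDatum (galFixing)
open Literature.AnabelianGeometry.AbsoluteAnabelian.Prop121vii (zmodToQmodZ)
open scoped Classical

namespace Literature.NumberTheory.GaloisRepresentations

namespace IdeleClassBar

variable {K : Type} [Field K] [NumberField K] (S : Finset (HeightOneSpectrum (𝓞 K)))

/-! ## §1. The layer invariants `inv_{E/K} ∘ layerKSCohomologyIso` -/

/-- **The invariant map of the layer `C_{K_S}^{V̄_E}`**: `inv_{E/K} ∘ (H²(G_S ⧸ V̄_E, C_{K_S}^{V̄_E}) ≅ H²(Gal(E/K), C_E))`.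
[cite: Harari2020, §16.1 Def. 16.3][cite: CasselsFrohlichANT1967, Ch. VII §11.2 (bis)] -/
def layerInvKS {E : GalLayer K} (hE : ramificationSubgroup K (↑S : Set (HeightOneSpectrum (𝓞 K))) ≤ galFixing K E.1) :
    groupCohomology (layerRepKS S E) 2 →+ AddCircle (1 : ℚ) :=
  haveI := E.numberField
  haveI := E.isGalois
  (IdeleCohomology.classInvAll K E.1).comp (layerKSCohomologyIso S hE 2).hom.hom.toAddMonoidHom

/-- Formula: `layerInvKS hE c = inv_{E/K} (iso_E c)`. [cite: Harari2020, §16.1 Def. 16.3] -/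
theorem layerInvKS_apply {E : GalLayer K}
    (hE : ramificationSubgroup K (↑S : Set (HeightOneSpectrum (𝓞 K))) ≤ galFixing K E.1) (c : groupCohomology (layerRepKS S E) 2) :
    layerInvKS S hE c = (haveI := E.numberField; haveI := E.isGalois;
      IdeleCohomology.classInvAll K E.1 ((layerKSCohomologyIso S hE 2).hom c)) := by
  rw [layerInvKS, AddMonoidHom.coe_comp, Function.comp_apply, LinearMap.toAddMonoidHom_coe]

/-- `layerInvKS hE (iso_E⁻¹ y) = inv_{E/K} y`. [cite: Harari2020, §16.1 Def. 16.3] -/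
theorem layerInvKS_iso_inv {E : GalLayer K}
    (hE : ramificationSubgroup K (↑S : Set (HeightOneSpectrum (𝓞 K))) ≤ galFixing K E.1)
    (y : groupCohomology (haveI := E.numberField; IdeleClassGroup.galoisRep K E.1) 2) :
    layerInvKS S hE ((layerKSCohomologyIso S hE 2).inv y) =
      (haveI := E.numberField; haveI := E.isGalois; IdeleCohomology.classInvAll K E.1 y) := by
  rw [layerInvKS_apply, ← ModuleCat.comp_apply, Iso.inv_hom_id, ModuleCat.id_apply]

/-- **`layerInvKS hE` is injective** (`inv_{E/K}` is). [cite: CasselsFrohlichANT1967, Ch. VII §11.2 (bis), Result] -/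
theorem layerInvKS_injective {E : GalLayer K}
    (hE : ramificationSubgroup K (↑S : Set (HeightOneSpectrum (𝓞 K))) ≤ galFixing K E.1) :
    Function.Injective (layerInvKS S hE) := by
  haveI := E.numberField
  haveI := E.isGalois
  intro c c' h
  rw [layerInvKS_apply, layerInvKS_apply] at h
  have h' := IdeleCohomology.classInvAll_injective K E.1 h
  have := congrArg (layerKSCohomologyIso S hE 2).inv h'
  rwa [← ModuleCat.comp_apply, ← ModuleCat.comp_apply, Iso.hom_inv_id, ModuleCat.id_apply, ModuleCat.id_apply] at this

/-- **The range of `layerInvKS hE` is `{q : [E:K] • q = 0} = (1/[E:K])ℤ/ℤ`.** [cite: CasselsFrohlichANT1967, Ch. VII §11.2 (bis), Result] -/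
theorem mem_range_layerInvKS_iff {E : GalLayer K}
    (hE : ramificationSubgroup K (↑S : Set (HeightOneSpectrum (𝓞 K))) ≤ galFixing K E.1) (q : AddCircle (1 : ℚ)) :
    q ∈ Set.range (layerInvKS S hE) ↔ Module.finrank K E.1 • q = 0 := by
  haveI := E.numberField
  haveI := E.isGalois
  haveI := IdeleCohomology.neZero_finrank K E.1
  constructor
  · rintro ⟨c, rfl⟩
    rw [layerInvKS_apply]
    exact IdeleCohomology.finrank_nsmul_classInvAll K E.1 _
  · intro hq
    have h1 : q ∈ Set.range (zmodToQmodZ (Module.finrank K E.1)) := UnitsLayer.mem_range_zmodToQmodZ_of_nsmul_eq_zero _ _ hq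
    rw [← IdeleCohomology.range_classInvAll K E.1] at h1
    obtain ⟨α, rfl⟩ := h1
    exact ⟨(layerKSCohomologyIso S hE 2).inv α, layerInvKS_iso_inv S hE α⟩

/-- **Compatibility with door-c4's transitions**: `layerInvKS hE' (stepG c) = layerInvKS hE c` for `E ≤ E'` inside `K_S`
(`inv_{E'/K} ∘ Inf = inv_{E/K}`, door-c6's `classInvAll_classInf`). [cite: CasselsFrohlichANT1967, Ch. VII §11.2 (diagram (4)) and (bis)] -/
theorem layerInvKS_stepG {E E' : GalLayer K} (h : E ≤ E')
    (hE : ramificationSubgroup K (↑S : Set (HeightOneSpectrum (𝓞 K))) ≤ galFixing K E.1)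
    (hE' : ramificationSubgroup K (↑S : Set (HeightOneSpectrum (𝓞 K))) ≤ galFixing K E'.1)
    (c : groupCohomology (layerRepKS S E) 2) :
    layerInvKS S hE' (LayerColimit.stepG (layerSubgroupS S E) (layerSubgroupS S E') (layerSubgroupS_anti S h)
        (classBarKSD K S) 2 c) = layerInvKS S hE c := by
  haveI := E.numberField
  haveI := E'.numberField
  haveI := E.isGalois
  haveI := E'.isGalois
  letI := GalLayer.algebraOfLE h
  haveI := GalLayer.isScalarTower_of_le h
  rw [layerInvKS_apply, layerInvKS_apply, layerKSCohomologyIso_hom_stepG S h hE hE' 2 c]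
  exact IdeleCohomology.classInvAll_classInf K E.1 E'.1 _

/-! ## §2. `inv_{K_S} : Ext²_{C_{G_S}}(ℤ, C_{K_S}) →+ ℚ/ℤ` -/

/-- **The layer invariants of `C_{K_S}` form a compatible family on the cofinal family `E ↦ V̄_E`, `E ⊂ K_S`.**
[cite: CasselsFrohlichANT1967, Ch. VII §11.2 (bis)][cite: SerreGaloisCohomology1997, I §2.2 Proposition 8] -/
theorem isCompatibleFamily_layerInvKS [TotallyDisconnectedSpace (GaloisGroupUnramifiedOutside K (↑S : Set (HeightOneSpectrum (𝓞 K))))] :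
    LayerColimit.IsCompatibleFamily (fun E : LayerKS S => layerSubgroupS S E.1) (classBarKSD K S) 2
      (fun E => layerInvKS S E.2) := by
  refine ⟨fun W => ?_, fun E E' h c => ?_⟩
  · obtain ⟨E, hE, hEW⟩ := exists_layerSubgroupS_le S W
    exact ⟨⟨E, hE⟩, hEW⟩
  · exact layerInvKS_stepG S (le_of_layerSubgroupS_le S E.2 h) E.2 E'.2 c

/-- **THE invariant map of `(G_S, C_{K_S})`, `inv_{K_S} : H²(G_S, C_{K_S}) = Ext²_{C_{G_S}}(ℤ, C_{K_S}) →+ ℚ/ℤ`** — the descent of the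
layer invariants `inv_{E/K}`, `E ⊂ K_S` (Tate's passage to the limit, restricted to the layers inside `K_S`).
[cite: Harari2020, §16.1 Def. 16.3, §17.1 Thm. 17.2][cite: CasselsFrohlichANT1967, Ch. VII §11.2 (bis)][cite: MilneADT2006, I §4] -/
def invKS : Abelian.Ext (triv (k := ℤ) (Γ := GaloisGroupUnramifiedOutside K (↑S : Set (HeightOneSpectrum (𝓞 K)))) ℤ)
    (classBarKSD K S) 2 →+ AddCircle (1 : ℚ) :=
  haveI := totallyDisconnectedSpace_GS S
  LayerColimit.desc (fun E : LayerKS S => layerSubgroupS S E.1) (classBarKSD K S) 2 (fun E => layerInvKS S E.2)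
    (isCompatibleFamily_layerInvKS S)

/-- **`inv_{K_S} (Inf_E c) = inv_{E/K} (iso_E c)`** on a class inflated from the layer `E ⊂ K_S`.
[cite: CasselsFrohlichANT1967, Ch. VII §11.2 (bis)][cite: Harari2020, §16.1 Def. 16.3] -/
theorem invKS_inflG {E : GalLayer K} (hE : ramificationSubgroup K (↑S : Set (HeightOneSpectrum (𝓞 K))) ≤ galFixing K E.1)
    (c : groupCohomology (layerRepKS S E) 2) :
    (haveI := totallyDisconnectedSpace_GS S; invKS S (LayerColimit.inflG (layerSubgroupS S E) (classBarKSD K S) 2 c)) =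
      layerInvKS S hE c :=
  haveI := totallyDisconnectedSpace_GS S
  LayerColimit.desc_inflG (isCompatibleFamily_layerInvKS S) ⟨E, hE⟩ c

/-- **Uniqueness**: an additive map `Ext²_{C_{G_S}}(ℤ, C_{K_S}) → ℚ/ℤ` agreeing with `inv_{E/K}` on every layer `E ⊂ K_S` is `inv_{K_S}`
(the form in which (★2) «inflation in stages» is to be checked). [cite: Harari2020, §16.1 Def. 16.3] -/
theorem eq_invKS_of_forall_inflG
    (g : Abelian.Ext (triv (k := ℤ) (Γ := GaloisGroupUnramifiedOutside K (↑S : Set (HeightOneSpectrum (𝓞 K)))) ℤ)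
      (classBarKSD K S) 2 →+ AddCircle (1 : ℚ))
    (hg : ∀ (E : GalLayer K) (hE : ramificationSubgroup K (↑S : Set (HeightOneSpectrum (𝓞 K))) ≤ galFixing K E.1)
      (c : groupCohomology (layerRepKS S E) 2),
      (haveI := totallyDisconnectedSpace_GS S; g (LayerColimit.inflG (layerSubgroupS S E) (classBarKSD K S) 2 c)) =
        layerInvKS S hE c) :
    g = invKS S :=
  haveI := totallyDisconnectedSpace_GS S
  LayerColimit.eq_desc_of_forall_inflG (isCompatibleFamily_layerInvKS S) g fun E c => hg E.1 E.2 c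

/-- **`inv_{K_S}` is injective** (each `inv_{E/K}` is). [cite: CasselsFrohlichANT1967, Ch. VII §11.2 (bis), Result] -/
theorem invKS_injective : Function.Injective (invKS S) :=
  haveI := totallyDisconnectedSpace_GS S
  LayerColimit.desc_injective (isCompatibleFamily_layerInvKS S) fun E => layerInvKS_injective S E.2

/-- Every value of `inv_{K_S}` is killed by the degree of some layer inside `K_S` (range `= ⋃_{E ⊂ K_S} (1/[E:K])ℤ/ℤ`).
[cite: Harari2020, §16.4 Remark 16.24 (b), §17.1 Remark 17.1] -/
theorem exists_finrank_nsmul_invKS_eq_zero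
    (x : Abelian.Ext (triv (k := ℤ) (Γ := GaloisGroupUnramifiedOutside K (↑S : Set (HeightOneSpectrum (𝓞 K)))) ℤ)
      (classBarKSD K S) 2) :
    ∃ (E : GalLayer K), ramificationSubgroup K (↑S : Set (HeightOneSpectrum (𝓞 K))) ≤ galFixing K E.1 ∧
      Module.finrank K E.1 • invKS S x = 0 := by
  haveI := totallyDisconnectedSpace_GS S
  obtain ⟨E, c, rfl⟩ := (isCompatibleFamily_layerInvKS S).exists_inflG_eq x
  refine ⟨E.1, E.2, ?_⟩
  rw [invKS_inflG S E.2]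
  exact (mem_range_layerInvKS_iff S E.2 _).1 ⟨c, rfl⟩

/-- **`inv_{K_S}` of the inflated fundamental class `u_{E/K}` is `1/[E:K]`.** [cite: CasselsFrohlichANT1967, Ch. VII §11.2 (bis), Result] -/
theorem invKS_inflG_fundamentalClassAll {E : GalLayer K}
    (hE : ramificationSubgroup K (↑S : Set (HeightOneSpectrum (𝓞 K))) ≤ galFixing K E.1) :
    haveI := E.numberField; haveI := E.isGalois; haveI := IdeleCohomology.neZero_finrank K E.1;
    haveI := totallyDisconnectedSpace_GS S;
    invKS S (LayerColimit.inflG (layerSubgroupS S E) (classBarKSD K S) 2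
        ((layerKSCohomologyIso S hE 2).inv (IdeleCohomology.fundamentalClassAll K E.1))) =
      zmodToQmodZ (Module.finrank K E.1) 1 := by
  haveI := E.numberField
  haveI := E.isGalois
  rw [invKS_inflG S hE, layerInvKS_iso_inv]
  exact IdeleCohomology.classInvAll_fundamentalClassAll K E.1

/-! ## §3. (★1) `inv_S ∘ (C_{K_S} ↠ C̄_S)_* = inv_{K_S}` -/

/-- **`inv_S (x ∘ [C_{K_S} ↠ C̄_S]) = inv_{K_S} (x)`** for every `x ∈ Ext²_{C_{G_S}}(ℤ, C_{K_S})` (Yoneda composition with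
`Ext.mk₀ (toClassBarSD K S)`): on a class inflated from the layer `E ⊂ K_S` both sides are `inv_{E/K}` of the corresponding class
of `H²(Gal(E/K), C_E)` — the pushforward reads `H²(π_E)` on the layer (door-c4's `LayerColimit.inflG_map` + `IdeleClassBarKSLayers`
§5) and `inv_{C_S(E)} ∘ H²(π_E) = inv_{E/K}` (`classModUnitsInv_map_π`; Harari Thm. 17.2: `U_{E,S}` is cohomologically trivial).
[cite: Harari2020, §17.1 Thm. 17.2][cite: MilneADT2006, I §4 (p. 55)] -/
theorem invS_comp_mk₀_toClassBarSD
    (x : Abelian.Ext (triv (k := ℤ) (Γ := GaloisGroupUnramifiedOutside K (↑S : Set (HeightOneSpectrum (𝓞 K)))) ℤ)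
      (classBarKSD K S) 2) :
    invS S (x.comp (Ext.mk₀ (toClassBarSD K S)) (add_zero 2)) = invKS S x := by
  haveI := totallyDisconnectedSpace_GS S
  -- `x` is inflated from a layer `E ⊂ K_S`; on the layer both sides are `inv_{E/K}` of the same class of `H²(Gal(E/K), C_E)`
  obtain ⟨E, c, rfl⟩ := (isCompatibleFamily_layerInvKS S).exists_inflG_eq x
  haveI := E.1.numberField
  haveI := E.1.isGalois
  rw [invKS_inflG S E.2, ← LayerColimit.inflG_map (layerSubgroupS S E.1) (toClassBarSD K S) 2 c, invS_inflG S E.2,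
    layerInvS_apply, layerInvKS_apply]
  have hsq : (layerSCohomologyIso S E.2 2).hom ((groupCohomology.map (MonoidHom.id _)
      ((DiscreteRep.invariantsQuotFunctor ℤ
        (layerSubgroupS S E.1 : Subgroup (GaloisGroupUnramifiedOutside K (↑S : Set (HeightOneSpectrum (𝓞 K)))))).map
        (toClassBarSD K S)) 2).hom c) =
      groupCohomology.map (MonoidHom.id _)
        (cokernel.π (IdeleCohomology.unitsOffToClass (F := K) (E := E.1.1) S) :
          IdeleClassGroup.galoisRep K E.1.1 ⟶ IdeleCohomology.classModUnitsRep K E.1.1 S) 2 ((layerKSCohomologyIso S E.2 2).hom c) :=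
    layerSCohomologyIso_hom_map_toClassBarSD S E.2 2 c
  rw [hsq]
  exact IdeleCohomology.classModUnitsInv_map_π S (forall_isUnramifiedIn_of_insideKS S E.2) _

end IdeleClassBar

end Literature.NumberTheory.GaloisRepresentations

end
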